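import Literature.MathematicalPhysics.StatisticalMechanics.Crystallization
import Mathlib.MeasureTheory.Measure.Lebesgue.EqHaar
import Mathlib.Analysis.PSeries
import Mathlib.Combinatorics.SimpleGraph.Connectivity.Connected
import HarnessLib

/-!
# Lennard-Jones clusters: existence of ground states and the uniform minimal distance

Topic: `Literature/MathematicalPhysics/StatisticalMechanics`. Two NAMED FACTS about finite
Lennard-Jones ground states in `ℝ³`, in the conventions of `Crystallization.lean`
(`Literature.StatMech.lennardJones r = r⁻¹²/12 - r⁻⁶/6`, `IsGroundState V x` = `x` injective with
`interactionEnergy V x = groundStateEnergy V d N`, the infimum over injective configurations).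
They are inputs (d) of route `AtomisticToContinuum/CrystalLocalRigidity` and the vacuity guards of
`IsCrystallizing lennardJones 3`.

## Content

* `LennardJonesGroundStatesExist` — for every `N` the `N`-particle Lennard-Jones energy in `ℝ³`
  has a minimiser among configurations of distinct points (Blanc–Lewin 2015, §1.2: "when `V` is
  continuous on `(0, ∞)` and negative at infinity, then `E(N)` always possesses minimizers", via
  the strict binding inequality (6) `E(N) < E(K) + E(N-K)`; for Lennard-Jones `V → +∞` at `0`, so
  minimising sequences of distinct points do not collapse and the minimiser is injective).
* `LennardJonesMinimalDistance` — there is `δ > 0` such that in every global minimiser, for every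
  `N`, all interparticle distances are `≥ δ` (Xue 1997, title theorem, explicit constant for
  `V = r⁻¹² - 2r⁻⁶`; Blanc 2004 improves the constant; surveyed in Blanc–Lewin 2015, §2.2:
  "the Lennard-Jones potential was covered in [Xue–Maier–Rosen, Maranas–Floudas, Xue 1997,
  Blanc 2004, Schachinger et al. 2007, Yuhjtman 2015]"). Vendored qualitatively (`∃ δ > 0`), which
  is invariant under the rescaling `r₀ = 1`, coefficients `1/12, 1/6` used here.
* `LennardJonesMinimalDistance_holds` — DISCHARGE of the second fact (appendix 1 at the end of
  the file): the removal inequality `∑_{k ≠ i} V_LJ(|xᵢ - x_k|) ≤ 0` at a ground state, a packing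
  bound by volume (`card_le_of_separated_of_dist_le`) and a shell sum give `δ = 1/3` in the
  present normalisation.
* `LennardJonesGroundStatesExist_holds` — DISCHARGE of the first fact (appendix 2): the argument
  printed in Blanc–Lewin 2015, §1.2 — strict binding (6) by induction on `N` from the minimisers
  of the smaller problems ("two groups of particles far away always attract each other",
  `groundStateEnergy_add_lt`), then the footnote to (6): below the binding level no group of
  particles escapes (`exists_level_of_binding`, `exists_far_or_forall_dist_le`), near-minimisers
  are bounded after a translation and `δ`-separated, and a minimiser exists by compactness and
  continuity of `V_LJ` on `(0, ∞)` (`exists_isGroundState_lennardJones_of_bounds`).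

## Sources

* X. Blanc, M. Lewin, *The crystallization conjecture: a review*, EMS Surv. Math. Sci. 2 (2015)
  255–306, arXiv:1504.01153, §1.2 (p. 4–5), §2.2 (p. 10).
* G. L. Xue, *Minimum inter-particle distance at global minimizers of Lennard-Jones clusters*,
  J. Global Optim. 11 (1997) 83–90.
* X. Blanc, *Lower bound for the interatomic distance in Lennard-Jones clusters*, Comput. Optim.
  Appl. 29 (2004) 5–12.

## Wording risks

* Both facts are stated for `d = 3` only (the printed setting), although the proofs are
  dimension-independent.
* `IsGroundState` here minimises over injective configurations with the real-valued
  `lennardJones` (`V(0) = 0` junk value never used); a global minimiser in the printed sense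
  (`V(0) = +∞`) is exactly a ground state in this sense, since coincident points have infinite
  printed energy and `V → +∞` at `0⁺`.
-/

noncomputable section

namespace Literature.MathematicalPhysics.StatisticalMechanics

/-- NAMED FACT — **existence of Lennard-Jones ground states** (Blanc–Lewin 2015, §1.2: for `V`
continuous on `(0,∞)`, tending to `0` and negative at infinity — in particular `V_LJ` — "`E(N)`
always possesses minimizers", by the strict binding inequalities (6)). For every `N` there is a
configuration of `N` distinct points in `ℝ³` realising `E(N)` for the Lennard-Jones potential.
Users take `(h : LennardJonesGroundStatesExist)`. [cite: BlancLewin2015, §1.2 (6)] -/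
def LennardJonesGroundStatesExist : Prop :=
  ∀ N : ℕ, ∃ x : Fin N → EuclideanSpace ℝ (Fin 3), IsGroundState lennardJones x

/-- NAMED FACT — **uniform minimal interparticle distance in Lennard-Jones ground states**
(Xue 1997; Blanc 2004; Blanc–Lewin 2015, §2.2: `min_{i ≠ j} |x_i - x_j| ≥ 2ε > 0` for a
minimiser of `𝓔_N`, uniformly in `N`, "the Lennard-Jones potential was covered in [250, 25, …]").
There is `δ > 0` such that for every `N` and every Lennard-Jones ground state `x` of `N` particles
in `ℝ³`, `|x_i - x_j| ≥ δ` for all `i ≠ j`. Qualitative form (the printed explicit constants refer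
to the normalisation `r⁻¹² - 2r⁻⁶`). Users take `(h : LennardJonesMinimalDistance)`.
[cite: Xue1997, Main Theorem; BlancLewin2015, §2.2] -/
def LennardJonesMinimalDistance : Prop :=
  ∃ δ : ℝ, 0 < δ ∧ ∀ (N : ℕ) (x : Fin N → EuclideanSpace ℝ (Fin 3)),
    IsGroundState lennardJones x → ∀ i j, i ≠ j → δ ≤ dist (x i) (x j)

/-! ## API -/

/-- Under the two facts, for every `N ≥ 2` the ground-state energy is realised by a configuration
whose points are `δ`-separated. [folklore] -/
theorem exists_isGroundState_separated (h₁ : LennardJonesGroundStatesExist)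
    (h₂ : LennardJonesMinimalDistance) :
    ∃ δ : ℝ, 0 < δ ∧ ∀ N : ℕ, ∃ x : Fin N → EuclideanSpace ℝ (Fin 3),
      IsGroundState lennardJones x ∧ ∀ i j, i ≠ j → δ ≤ dist (x i) (x j) := by
  obtain ⟨δ, hδ, h⟩ := h₂
  refine ⟨δ, hδ, fun N => ?_⟩
  obtain ⟨x, hx⟩ := h₁ N
  exact ⟨x, hx, h N x hx⟩

end Literature.MathematicalPhysics.StatisticalMechanics

end

/-! ## Appendix 1: proof of `LennardJonesMinimalDistance` (discharge, `δ = 1/3`)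

The fact is discharged below (`LennardJonesMinimalDistance_holds`) by the standard
removal-plus-packing argument (the qualitative content of Xue 1997 and Blanc 2004; the explicit
constants printed there, for the normalisation `r⁻¹² - 2r⁻⁶`, are not reproduced — we obtain
`δ = 1/3` for `V_LJ = r⁻¹²/12 - r⁻⁶/6`):

1. `two_mul_interactionEnergy`: `2 𝓔_N(x) = ∑ᵢ 𝓔ⁱ(x)` with the site energies
   `𝓔ⁱ(x) = ∑_{k ≠ i} V(|xᵢ - x_k|)` (`siteEnergy`).
2. `siteEnergy_nonpos_of_isGroundState`: in a Lennard-Jones ground state every particle has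
   site energy `≤ 0` — move `xᵢ` to a point at distance `≥ 1` from all particles, where
   `V_LJ ≤ 0`, and compare with `E(N)`.
3. `card_le_of_separated_of_dist_le`: `r`-separated points in a ball of radius `R` of an
   `n`-dimensional normed space number at most `(2R/r + 1)ⁿ` (volumes of disjoint balls; the
   argument of Mathlib's `Besicovitch.card_le_of_separated`).
4. `sum_inv_pow_six_le`: if all mutual distances in `x` are `≥ r`, then
   `∑_{k ≠ i} |xᵢ - x_k|⁻⁶ ≤ 250 r⁻⁶` (shells `⌊|xᵢ - x_k|/r⌋ = b` hold `≤ (2b+3)³ ≤ 125 b³`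
   particles by 3., and `∑_b b⁻² ≤ 2`).
5. Assembly: at a closest pair `(i₀, j₀)`, `r = |x_{i₀} - x_{j₀}|`, we get
   `0 ≥ 𝓔^{i₀} ≥ r⁻¹²/12 - (250/6) r⁻⁶`, i.e. `r⁻⁶ ≤ 500 < 3⁶`, so `r > 1/3`.
-/

noncomputable section

open scoped BigOperators ENNReal
open Metric Set Module MeasureTheory

namespace Literature.MathematicalPhysics.StatisticalMechanics

/-! ### Packing -/

open scoped Function in
/-- **Packing bound by volume.** In an `n`-dimensional real normed space, finitely many points of
the ball `dist · p ≤ R` with mutual distances `≥ r > 0` number at most `(2R/r + 1)ⁿ`: the balls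
of radius `r/2` about them are disjoint and contained in the ball of radius `R + r/2` about `p`
(the argument of Mathlib's `Besicovitch.card_le_of_separated`, with general radii). [folklore] -/
theorem card_le_of_separated_of_dist_le {E : Type*} [NormedAddCommGroup E] [NormedSpace ℝ E]
    [FiniteDimensional ℝ E] (s : Finset E) (p : E) {r R : ℝ} (hr : 0 < r) (hR : 0 ≤ R)
    (hs : ∀ c ∈ s, dist c p ≤ R) (h : ∀ c ∈ s, ∀ d ∈ s, c ≠ d → r ≤ dist c d) :
    (s.card : ℝ) ≤ (2 * R / r + 1) ^ finrank ℝ E := by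
  borelize E
  let μ : Measure E := Measure.addHaar
  set δ : ℝ := r / 2 with hδ
  set ρ : ℝ := R + r / 2 with hρ
  have δpos : 0 < δ := by positivity
  have ρpos : 0 < ρ := by positivity
  set A := ⋃ c ∈ s, ball (c : E) δ with hA
  have D : Set.Pairwise (s : Set E) (Disjoint on fun c => ball (c : E) δ) := by
    rintro c hc d hd hcd
    apply ball_disjoint_ball
    have := h c hc d hd hcd
    linarith
  have A_subset : A ⊆ ball p ρ := by
    refine iUnion₂_subset fun x hx => ?_
    apply ball_subset_ball'
    have := hs x hx
    linarith
  have I : (s.card : ℝ≥0∞) * ENNReal.ofReal (δ ^ finrank ℝ E) * μ (ball 0 1) ≤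
      ENNReal.ofReal (ρ ^ finrank ℝ E) * μ (ball 0 1) :=
    calc (s.card : ℝ≥0∞) * ENNReal.ofReal (δ ^ finrank ℝ E) * μ (ball 0 1) = μ A := by
          rw [hA, measure_biUnion_finset D fun c _ => measurableSet_ball]
          simp only [μ.addHaar_ball_of_pos _ δpos]
          simp only [Finset.sum_const, nsmul_eq_mul, mul_assoc]
      _ ≤ μ (ball p ρ) := measure_mono A_subset
      _ = ENNReal.ofReal (ρ ^ finrank ℝ E) * μ (ball 0 1) := by
          simp only [μ.addHaar_ball_of_pos _ ρpos]
  have J : (s.card : ℝ≥0∞) * ENNReal.ofReal (δ ^ finrank ℝ E) ≤ ENNReal.ofReal (ρ ^ finrank ℝ E) :=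
    (ENNReal.mul_le_mul_iff_left (measure_ball_pos _ _ zero_lt_one).ne' measure_ball_lt_top.ne).1 I
  have K : (s.card : ℝ) * δ ^ finrank ℝ E ≤ ρ ^ finrank ℝ E := by
    have := ENNReal.toReal_le_of_le_ofReal (pow_nonneg ρpos.le _) J
    simpa [ENNReal.toReal_mul, ENNReal.toReal_ofReal (pow_nonneg δpos.le _)] using this
  have hδn : 0 < δ ^ finrank ℝ E := pow_pos δpos _
  have hq : ρ / δ = 2 * R / r + 1 := by
    rw [hρ, hδ]
    field_simp
  calc (s.card : ℝ) ≤ ρ ^ finrank ℝ E / δ ^ finrank ℝ E := by rw [le_div_iff₀ hδn]; exact K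
    _ = (2 * R / r + 1) ^ finrank ℝ E := by rw [← div_pow, hq]

/-! ### Site energies and the removal inequality -/

section Site

variable {d N : ℕ}

/-- The energy of particle `i` in the configuration `x`, `𝓔ⁱ(x) = ∑_{k ≠ i} V(|xᵢ - x_k|)`.
[folklore] -/
def siteEnergy (V : ℝ → ℝ) (x : Fin N → EuclideanSpace ℝ (Fin d)) (i : Fin N) : ℝ :=
  ∑ k ∈ Finset.univ.erase i, V (dist (x i) (x k))

/-- Double counting: `2 𝓔_N(x) = ∑ᵢ 𝓔ⁱ(x)`. [folklore] -/
theorem two_mul_interactionEnergy (V : ℝ → ℝ) (x : Fin N → EuclideanSpace ℝ (Fin d)) :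
    2 * interactionEnergy V x = ∑ i, siteEnergy V x i := by
  have hsplit : ∀ i : Fin N, Finset.univ.erase i = Finset.Ioi i ∪ Finset.Iio i := fun i => by
    ext k
    simp only [Finset.mem_erase, Finset.mem_univ, and_true, Finset.mem_union, Finset.mem_Ioi,
      Finset.mem_Iio]
    exact ne_iff_lt_or_gt.trans or_comm
  have hdisj : ∀ i : Fin N, Disjoint (Finset.Ioi i) (Finset.Iio i) := fun i =>
    Finset.disjoint_left.2 fun k hk hk' => lt_asymm (Finset.mem_Ioi.1 hk) (Finset.mem_Iio.1 hk')
  have h1 : ∑ i, ∑ k ∈ Finset.Iio i, V (dist (x i) (x k)) = interactionEnergy V x := by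
    unfold interactionEnergy
    rw [Finset.sum_comm' (t' := Finset.univ) (s' := fun k => Finset.Ioi k)]
    · exact Finset.sum_congr rfl fun k _ => Finset.sum_congr rfl fun i _ => by rw [dist_comm]
    · intro i k
      simp
  simp only [siteEnergy, hsplit, Finset.sum_union (hdisj _), Finset.sum_add_distrib, h1]
  unfold interactionEnergy
  ring

/-- Replacing particle `i` by a particle at `y` changes `∑ᵢ 𝓔ⁱ` by twice the change of the site
energy of `i`. [folklore] -/
theorem sum_siteEnergy_update_sub (V : ℝ → ℝ) (x : Fin N → EuclideanSpace ℝ (Fin d)) (i : Fin N)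
    (y : EuclideanSpace ℝ (Fin d)) :
    ∑ a, siteEnergy V (Function.update x i y) a - ∑ a, siteEnergy V x a =
      2 * (∑ k ∈ Finset.univ.erase i, V (dist y (x k)) - siteEnergy V x i) := by
  rw [← Finset.sum_sub_distrib, ← Finset.add_sum_erase _ _ (Finset.mem_univ i)]
  have hi : siteEnergy V (Function.update x i y) i =
      ∑ k ∈ Finset.univ.erase i, V (dist y (x k)) := by
    unfold siteEnergy
    refine Finset.sum_congr rfl fun k hk => ?_
    rw [Function.update_self, Function.update_of_ne (Finset.ne_of_mem_erase hk)]
  have ha : ∀ a ∈ Finset.univ.erase i,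
      siteEnergy V (Function.update x i y) a - siteEnergy V x a
        = V (dist (x a) y) - V (dist (x a) (x i)) := by
    intro a ha
    have hai : a ≠ i := Finset.ne_of_mem_erase ha
    unfold siteEnergy
    rw [← Finset.sum_sub_distrib,
      ← Finset.add_sum_erase _ _ (Finset.mem_erase.2 ⟨hai.symm, Finset.mem_univ i⟩),
      Function.update_of_ne hai, Function.update_self, Finset.sum_eq_zero, add_zero]
    intro k hk
    have hki : k ≠ i := Finset.ne_of_mem_erase hk
    rw [Function.update_of_ne hki, sub_self]
  rw [Finset.sum_congr rfl ha, hi, Finset.sum_sub_distrib]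
  simp_rw [dist_comm _ y, dist_comm _ (x i)]
  unfold siteEnergy
  ring

/-- `V_LJ(s) ≤ 0` for `s ≥ 1` (`V_LJ = (u/12)(u - 2)` with `u = s⁻⁶ ≤ 1`).
[cite: BlancLewin2015, §1.1 (3)] -/
theorem lennardJones_nonpos {s : ℝ} (hs : 1 ≤ s) : lennardJones s ≤ 0 := by
  unfold lennardJones
  have h1 : s⁻¹ ≤ 1 := inv_le_one_of_one_le₀ hs
  have h0 : 0 ≤ s⁻¹ := inv_nonneg.2 (by linarith)
  have h6 : (s⁻¹) ^ 6 ≤ 1 := pow_le_one₀ h0 h1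
  have h12 : (s⁻¹) ^ 12 = ((s⁻¹) ^ 6) ^ 2 := by ring
  rw [h12]
  nlinarith [pow_nonneg h0 6, mul_nonneg (pow_nonneg h0 6) (sub_nonneg.2 h6)]

/-- **Removal inequality.** In a Lennard-Jones ground state every particle has non-positive site
energy, `∑_{k ≠ i} V_LJ(|xᵢ - x_k|) ≤ 0`: moving `xᵢ` to a point at distance `≥ 1` from all
particles (where `V_LJ ≤ 0`) yields a configuration of distinct points, whose energy is `≥ E(N)`.
[folklore] -/
theorem siteEnergy_nonpos_of_isGroundState (hd : 0 < d) {x : Fin N → EuclideanSpace ℝ (Fin d)}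
    (hx : IsGroundState lennardJones x) (i : Fin N) : siteEnergy lennardJones x i ≤ 0 := by
  -- a far point `y`
  set c : ℝ := 1 + ∑ k, ‖x k‖ with hc
  set y : EuclideanSpace ℝ (Fin d) := EuclideanSpace.single (⟨0, hd⟩ : Fin d) c with hy_def
  have hc0 : 0 ≤ c := add_nonneg zero_le_one (Finset.sum_nonneg fun k _ => norm_nonneg (x k))
  have hyn : ‖y‖ = c := by simp [hy_def, abs_of_nonneg hc0]
  have hy : ∀ k, 1 ≤ dist y (x k) := fun k => by
    have h1 : ‖x k‖ ≤ ∑ l, ‖x l‖ :=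
      Finset.single_le_sum (f := fun l => ‖x l‖) (fun l _ => norm_nonneg _) (Finset.mem_univ k)
    have h2 : ‖y‖ - ‖x k‖ ≤ dist y (x k) := by rw [dist_eq_norm]; exact norm_sub_norm_le y (x k)
    linarith
  have hy' : ∀ k, y ≠ x k := fun k h => by
    have := hy k
    rw [h, dist_self] at this
    exact absurd this (by norm_num)
  -- the modified configuration consists of distinct points
  have hinj : Function.Injective (Function.update x i y) := by
    intro a b hab
    by_cases ha : a = i <;> by_cases hb : b = i
    · exact ha.trans hb.symm
    · subst ha
      rw [Function.update_self, Function.update_of_ne hb] at hab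
      exact absurd hab (hy' b)
    · subst hb
      rw [Function.update_self, Function.update_of_ne ha] at hab
      exact absurd hab.symm (hy' a)
    · rw [Function.update_of_ne ha, Function.update_of_ne hb] at hab
      exact hx.1 hab
  have hle : interactionEnergy lennardJones x ≤
      interactionEnergy lennardJones (Function.update x i y) := by
    rw [hx.2]
    exact groundStateEnergy_lennardJones_le hinj
  have hdiff := sum_siteEnergy_update_sub lennardJones x i y
  have hneg : ∑ k ∈ Finset.univ.erase i, lennardJones (dist y (x k)) ≤ 0 :=
    Finset.sum_nonpos fun k _ => lennardJones_nonpos (hy k)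
  have h2 := two_mul_interactionEnergy lennardJones x
  have h2' := two_mul_interactionEnergy lennardJones (Function.update x i y)
  linarith

end Site

/-! ### The shell sum -/

/-- **Shell sum.** If all mutual distances in the configuration `x` (in `ℝ³`) are `≥ r > 0`, then
`∑_{k ≠ i} |xᵢ - x_k|⁻⁶ ≤ 250 · r⁻⁶`: the shell `⌊|xᵢ - x_k| / r⌋ = b` (`b ≥ 1`) contains at most
`(2b + 3)³ ≤ 125 b³` particles by the packing bound, each contributing `≤ (b r)⁻⁶`, and
`∑_{b ≥ 1} b⁻³ ≤ ∑_{b ≥ 1} b⁻² ≤ 2`. [folklore] -/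
theorem sum_inv_pow_six_le {N : ℕ} (x : Fin N → EuclideanSpace ℝ (Fin 3)) {r : ℝ} (hr : 0 < r)
    (hsep : ∀ k l, k ≠ l → r ≤ dist (x k) (x l)) (i : Fin N) :
    ∑ k ∈ Finset.univ.erase i, (dist (x i) (x k))⁻¹ ^ 6 ≤ 250 * r⁻¹ ^ 6 := by
  set s := Finset.univ.erase i with hs_def
  set m : Fin N → ℕ := fun k => ⌊dist (x i) (x k) / r⌋₊ with hm
  set t := s.image m with ht_def
  have hmem : ∀ k ∈ s, m k ∈ t := fun k hk => Finset.mem_image_of_mem m hk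
  have hks : ∀ k ∈ s, r ≤ dist (x i) (x k) := fun k hk =>
    hsep i k (Finset.ne_of_mem_erase hk).symm
  have hm1 : ∀ k ∈ s, 1 ≤ m k := fun k hk =>
    (Nat.one_le_floor_iff _).2 ((one_le_div hr).2 (hks k hk))
  have hmle : ∀ k ∈ s, r * m k ≤ dist (x i) (x k) := fun k hk => by
    have := Nat.floor_le (div_nonneg dist_nonneg hr.le : 0 ≤ dist (x i) (x k) / r)
    rwa [le_div_iff₀ hr, mul_comm] at this
  have hmlt : ∀ k ∈ s, dist (x i) (x k) < (m k + 1) * r := fun k hk => by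
    have := Nat.lt_floor_add_one (dist (x i) (x k) / r)
    rwa [div_lt_iff₀ hr] at this
  -- termwise: `|xᵢ - x_k|⁻⁶ ≤ (r m_k)⁻⁶`
  have step1 : ∑ k ∈ s, (dist (x i) (x k))⁻¹ ^ 6 ≤ ∑ k ∈ s, r⁻¹ ^ 6 * ((m k : ℝ))⁻¹ ^ 6 := by
    refine Finset.sum_le_sum fun k hk => ?_
    rw [← mul_pow, ← mul_inv]
    have h0 : 0 < r * m k := mul_pos hr (by exact_mod_cast hm1 k hk)
    exact pow_le_pow_left₀ (inv_nonneg.2 dist_nonneg) (inv_anti₀ h0 (hmle k hk)) _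
  -- regroup by shells
  have step2 : ∑ k ∈ s, r⁻¹ ^ 6 * ((m k : ℝ))⁻¹ ^ 6 =
      ∑ b ∈ t, ((s.filter fun k => m k = b).card : ℝ) * (r⁻¹ ^ 6 * ((b : ℝ))⁻¹ ^ 6) := by
    have := Finset.sum_fiberwise_of_maps_to' hmem (fun b : ℕ => r⁻¹ ^ 6 * ((b : ℝ))⁻¹ ^ 6)
    simp only [Finset.sum_const, nsmul_eq_mul] at this
    exact this.symm
  -- each shell holds at most `(2b+3)³` particles
  have step3 : ∀ b ∈ t, ((s.filter fun k => m k = b).card : ℝ) ≤ (2 * (b : ℝ) + 3) ^ 3 := by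
    intro b hb
    set F := s.filter fun k => m k = b with hF
    have hinj : Set.InjOn x F := fun k _ l _ hkl => by
      by_contra hne
      have := hsep k l hne
      rw [hkl, dist_self] at this
      exact absurd this (not_le.2 hr)
    rw [← Finset.card_image_of_injOn hinj]
    have hR : (0 : ℝ) ≤ ((b : ℝ) + 1) * r := by positivity
    have := card_le_of_separated_of_dist_le (F.image x) (x i) hr hR ?_ ?_
    · rw [finrank_euclideanSpace_fin] at this
      convert this using 2
      field_simp
      ring
    · intro c hc
      obtain ⟨k, hk, rfl⟩ := Finset.mem_image.1 hc
      obtain ⟨hks', hkb⟩ := Finset.mem_filter.1 hk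
      rw [dist_comm]
      have := hmlt k hks'
      rw [hkb] at this
      exact this.le
    · intro c hc c' hc' hne
      obtain ⟨k, -, rfl⟩ := Finset.mem_image.1 hc
      obtain ⟨l, -, rfl⟩ := Finset.mem_image.1 hc'
      exact hsep k l fun h => hne (h ▸ rfl)
  -- numerics per shell: `(2b+3)³ b⁻⁶ ≤ 125 b⁻²` for `b ≥ 1`
  have step4 : ∀ b ∈ t, (2 * (b : ℝ) + 3) ^ 3 * (r⁻¹ ^ 6 * ((b : ℝ))⁻¹ ^ 6) ≤
      125 * r⁻¹ ^ 6 * ((b : ℝ) ^ 2)⁻¹ := by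
    intro b hb
    obtain ⟨k, hk, rfl⟩ := Finset.mem_image.1 hb
    have hb1 : (1 : ℝ) ≤ (m k : ℝ) := by exact_mod_cast hm1 k hk
    set β : ℝ := (m k : ℝ)
    have hβ : 0 < β := by linarith
    have hr6 : 0 < r⁻¹ ^ 6 := by positivity
    have key : (2 * β + 3) ^ 3 * (β⁻¹) ^ 6 ≤ 125 * (β ^ 2)⁻¹ := by
      rw [inv_pow, ← div_eq_mul_inv, ← div_eq_mul_inv,
        div_le_div_iff₀ (by positivity) (by positivity)]
      have h5 : (2 * β + 3) ^ 3 ≤ (5 * β) ^ 3 :=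
        pow_le_pow_left₀ (by positivity) (by linarith) 3
      have h6 : β ^ 5 ≤ β ^ 6 := pow_le_pow_right₀ hb1 (by norm_num)
      nlinarith [mul_le_mul_of_nonneg_right h5 (sq_nonneg β)]
    calc (2 * β + 3) ^ 3 * (r⁻¹ ^ 6 * (β⁻¹) ^ 6) = r⁻¹ ^ 6 * ((2 * β + 3) ^ 3 * (β⁻¹) ^ 6) := by
          ring
      _ ≤ r⁻¹ ^ 6 * (125 * (β ^ 2)⁻¹) := mul_le_mul_of_nonneg_left key hr6.le
      _ = 125 * r⁻¹ ^ 6 * (β ^ 2)⁻¹ := by ring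
  -- `∑_{b ∈ t} b⁻² ≤ 2`
  have step5 : ∑ b ∈ t, ((b : ℝ) ^ 2)⁻¹ ≤ 2 := by
    have hsub : t ⊆ Finset.Ioo 0 (t.sup id + 1) := fun b hb => by
      rw [Finset.mem_Ioo]
      obtain ⟨k, hk, rfl⟩ := Finset.mem_image.1 hb
      exact ⟨hm1 k hk, Nat.lt_succ_of_le (Finset.le_sup (f := id) hb)⟩
    have h2 := sum_Ioo_inv_sq_le (α := ℝ) 0 (t.sup id + 1)
    calc ∑ b ∈ t, ((b : ℝ) ^ 2)⁻¹ ≤ ∑ b ∈ Finset.Ioo 0 (t.sup id + 1), ((b : ℝ) ^ 2)⁻¹ :=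
          Finset.sum_le_sum_of_subset_of_nonneg hsub fun b _ _ => by positivity
      _ ≤ 2 := by simpa using h2
  have hr6 : 0 ≤ r⁻¹ ^ 6 := by positivity
  calc ∑ k ∈ s, (dist (x i) (x k))⁻¹ ^ 6
      ≤ ∑ b ∈ t, ((s.filter fun k => m k = b).card : ℝ) * (r⁻¹ ^ 6 * ((b : ℝ))⁻¹ ^ 6) :=
        step1.trans_eq step2
    _ ≤ ∑ b ∈ t, (2 * (b : ℝ) + 3) ^ 3 * (r⁻¹ ^ 6 * ((b : ℝ))⁻¹ ^ 6) :=
        Finset.sum_le_sum fun b hb => mul_le_mul_of_nonneg_right (step3 b hb) (by positivity)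
    _ ≤ ∑ b ∈ t, 125 * r⁻¹ ^ 6 * ((b : ℝ) ^ 2)⁻¹ := Finset.sum_le_sum step4
    _ = 125 * r⁻¹ ^ 6 * ∑ b ∈ t, ((b : ℝ) ^ 2)⁻¹ := by rw [Finset.mul_sum]
    _ ≤ 125 * r⁻¹ ^ 6 * 2 := mul_le_mul_of_nonneg_left step5 (by positivity)
    _ = 250 * r⁻¹ ^ 6 := by ring

/-! ### The discharge -/

/-- **Uniform minimal distance in Lennard-Jones ground states** (discharge of
`LennardJonesMinimalDistance`, with `δ = 1/3` in the normalisation `V_LJ = r⁻¹²/12 - r⁻⁶/6`):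
at a closest pair `(i₀, j₀)` of a ground state, `r = |x_{i₀} - x_{j₀}|`, the removal inequality
and the shell sum give `0 ≥ 𝓔^{i₀}(x) ≥ r⁻¹²/12 - (250/6) r⁻⁶`, whence `r⁻⁶ ≤ 500 < 3⁶`.
Qualitative content of Xue 1997 (explicit constant there for `r⁻¹² - 2r⁻⁶`, not reproduced).
[cite: Xue1997, Main Theorem; BlancLewin2015, §2.2] -/
theorem LennardJonesMinimalDistance_holds : LennardJonesMinimalDistance := by
  refine ⟨1 / 3, by norm_num, fun N x hx i j hij => ?_⟩
  by_contra hlt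
  rw [not_le] at hlt
  -- a closest pair `(i₀, j₀)`
  obtain ⟨p, hp, hmin⟩ := Finset.exists_min_image Finset.univ.offDiag
    (fun p : Fin N × Fin N => dist (x p.1) (x p.2)) ⟨(i, j), by simp [hij]⟩
  obtain ⟨i₀, j₀⟩ := p
  have hij₀ : i₀ ≠ j₀ := by simpa using hp
  set r := dist (x i₀) (x j₀) with hr_def
  have hr : 0 < r := dist_pos.2 (hx.1.ne hij₀)
  have hsep : ∀ k l, k ≠ l → r ≤ dist (x k) (x l) := fun k l hkl => hmin (k, l) (by simp [hkl])
  have hr3 : r < 1 / 3 := (hsep i j hij).trans_lt hlt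
  -- the site energy of `i₀`
  have h0 := siteEnergy_nonpos_of_isGroundState (by norm_num) hx i₀
  have hS := sum_inv_pow_six_le x hr hsep i₀
  have h12 : r⁻¹ ^ 12 ≤ ∑ k ∈ Finset.univ.erase i₀, (dist (x i₀) (x k))⁻¹ ^ 12 := by
    have hj : j₀ ∈ Finset.univ.erase i₀ := Finset.mem_erase.2 ⟨hij₀.symm, Finset.mem_univ _⟩
    exact Finset.single_le_sum (f := fun k => (dist (x i₀) (x k))⁻¹ ^ 12)
      (fun k _ => by positivity) hj
  have hexp : siteEnergy lennardJones x i₀ =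
      (1 / 12) * ∑ k ∈ Finset.univ.erase i₀, (dist (x i₀) (x k))⁻¹ ^ 12 -
        (1 / 6) * ∑ k ∈ Finset.univ.erase i₀, (dist (x i₀) (x k))⁻¹ ^ 6 := by
    simp only [siteEnergy, lennardJones, Finset.sum_sub_distrib, Finset.mul_sum]
  have hu : (729 : ℝ) < r⁻¹ ^ 6 := by
    have h3 : 3 < r⁻¹ := by
      rw [lt_inv_comm₀ (by norm_num) hr]
      have : (3 : ℝ)⁻¹ = 1 / 3 := by norm_num
      linarith
    calc (729 : ℝ) = 3 ^ 6 := by norm_num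
      _ < r⁻¹ ^ 6 := pow_lt_pow_left₀ h3 (by norm_num) (by norm_num)
  have h12' : r⁻¹ ^ 12 = (r⁻¹ ^ 6) ^ 2 := by ring
  have hu' : 729 * r⁻¹ ^ 6 < r⁻¹ ^ 6 * r⁻¹ ^ 6 := mul_lt_mul_of_pos_right hu (by linarith)
  rw [h12', sq] at h12
  linarith

end Literature.MathematicalPhysics.StatisticalMechanics

end

/-! ## Appendix 2: proof of `LennardJonesGroundStatesExist` (discharge)

The first fact is discharged below (`LennardJonesGroundStatesExist_holds`) by the argument printed
in Blanc–Lewin 2015, §1.2 (p. 3): strong induction on `N`, in any dimension `d ≥ 1` (specialised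
to `d = 3` at the end).

1. `interactionEnergy_append`, `two_mul_groundStateEnergy_card_le`: bookkeeping with the full
   double sum `2 𝓔_N(x) = ∑ᵢ ∑_k V(|xᵢ - x_k|)` (valid since `V_LJ(0) = 0` with Lean's `0⁻¹ = 0`,
   a junk value never met by distinct points): the energy of two juxtaposed clusters, and the
   bound `≥ E(#S)` for the energy of the sub-configuration indexed by `S`.
2. `groundStateEnergy_add_lt`: the strict binding inequality (6), `E(K + M) < E(K) + E(M)`, given
   minimisers of the `K`- and `M`-particle problems — translate one of them far away; all cross
   distances exceed `1`, where `V_LJ < 0` ("two groups of particles far away always attract each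
   other").
3. `exists_far_or_forall_dist_le`: the escape dichotomy — either a non-empty proper group of
   particles is farther than `t` from the rest, or all particles are within `(N - 1) t` of each
   other (paths in the graph `|xᵢ - x_k| ≤ t`).
4. `le_interactionEnergy_of_far`, `exists_level_of_binding`: if a group `S` escapes farther than
   `t`, the energy is `≥ E(#S) + E(N - #S) - N² t⁻⁶/6`; with the binding gap this exceeds a level
   `B' > E(N)` for `t` large ("if `K` particles escape, we get a contradiction from (6)").
5. `min_le_of_lennardJones_lt`, `lennardJones_dist_le_two_mul_interactionEnergy`: an energy bound
   forces a minimal distance `δ > 0` (`V_LJ → +∞` at `0⁺`, `V_LJ ≥ -1/12`), so near-minimisers of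
   distinct points do not collapse.
6. `exists_isGroundState_lennardJones_of_bounds`: after translating one particle to the origin,
   configurations with energy `< B'` lie in a compact set on which the energy is continuous
   (`continuousOn_interactionEnergy_lennardJones`, `isCompact_setOf_normalised`); a minimiser
   there is a ground state ("we get the existence of a minimizer using the continuity of `V`").
7. `exists_isGroundState_lennardJones_of_lt` (the induction step) and
   `LennardJonesGroundStatesExist_holds`.
-/

noncomputable section

open scoped BigOperators
open Metric Set

namespace Literature.MathematicalPhysics.StatisticalMechanics

/-! ### Full double sums (potentials with `V 0 = 0`) -/

section DoubleSum

variable (V : ℝ → ℝ) {d N : ℕ}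

/-- Translation invariance of the interaction energy. [folklore] -/
theorem interactionEnergy_add_const (x : Fin N → EuclideanSpace ℝ (Fin d))
    (c : EuclideanSpace ℝ (Fin d)) :
    interactionEnergy V (fun i => x i + c) = interactionEnergy V x := by
  simp [interactionEnergy, dist_add_right]

/-- Translation invariance of the interaction energy (subtractive form). [folklore] -/
theorem interactionEnergy_sub_const (x : Fin N → EuclideanSpace ℝ (Fin d))
    (c : EuclideanSpace ℝ (Fin d)) :
    interactionEnergy V (fun i => x i - c) = interactionEnergy V x := by
  simp [interactionEnergy]

/-- For a potential with `V 0 = 0` (e.g. `V_LJ` with Lean's `0⁻¹ = 0`), twice the energy is the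
full double sum `∑ᵢ ∑ₖ V(|xᵢ - x_k|)`, diagonal included. [folklore] -/
theorem two_mul_interactionEnergy_eq_sum_sum (hV : V 0 = 0)
    (x : Fin N → EuclideanSpace ℝ (Fin d)) :
    2 * interactionEnergy V x = ∑ i, ∑ k, V (dist (x i) (x k)) := by
  rw [two_mul_interactionEnergy]
  refine Finset.sum_congr rfl fun i _ => ?_
  unfold siteEnergy
  rw [← Finset.add_sum_erase Finset.univ _ (Finset.mem_univ i), dist_self, hV, zero_add]

/-- Reindexing a sub-configuration along an injection `f : Fin K ↪ Fin N`. [folklore] -/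
theorem sum_sum_map_eq_two_mul_interactionEnergy (hV : V 0 = 0)
    (x : Fin N → EuclideanSpace ℝ (Fin d)) {K : ℕ} (f : Fin K ↪ Fin N) :
    ∑ i ∈ Finset.univ.map f, ∑ k ∈ Finset.univ.map f, V (dist (x i) (x k)) =
      2 * interactionEnergy V (x ∘ f) := by
  rw [two_mul_interactionEnergy_eq_sum_sum V hV]
  simp [Finset.sum_map]

/-- **Sub-configurations cost at least `E(K)`.** For `V` bounded below with `V 0 = 0` and an
injective configuration `x`, the double sum over any index set `S` is at least `2 E(#S)`.
[folklore] -/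
theorem two_mul_groundStateEnergy_card_le (hV : V 0 = 0) {c : ℝ} (hc : ∀ r, c ≤ V r)
    {x : Fin N → EuclideanSpace ℝ (Fin d)} (hx : Function.Injective x) (S : Finset (Fin N)) :
    2 * groundStateEnergy V d S.card ≤ ∑ i ∈ S, ∑ k ∈ S, V (dist (x i) (x k)) := by
  set f := S.orderEmbOfFin rfl with hf
  have hS : Finset.univ.map f.toEmbedding = S := Finset.map_orderEmbOfFin_univ S rfl
  have key := sum_sum_map_eq_two_mul_interactionEnergy V hV x f.toEmbedding
  rw [hS] at key
  rw [key]
  exact mul_le_mul_of_nonneg_left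
    (groundStateEnergy_le_of_le V hc (hx.comp f.toEmbedding.injective)) zero_le_two

/-- **Two clusters.** For `V 0 = 0`, the energy of the juxtaposition `Fin.append y z` of two
configurations is `𝓔(y) + 𝓔(z) + ∑ᵢ ∑ⱼ V(|yᵢ - zⱼ|)`. [folklore] -/
theorem interactionEnergy_append (hV : V 0 = 0) {K M : ℕ}
    (y : Fin K → EuclideanSpace ℝ (Fin d)) (z : Fin M → EuclideanSpace ℝ (Fin d)) :
    interactionEnergy V (Fin.append y z) =
      interactionEnergy V y + interactionEnergy V z + ∑ i, ∑ j, V (dist (y i) (z j)) := by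
  have h := two_mul_interactionEnergy_eq_sum_sum V hV (Fin.append y z)
  simp only [Fin.sum_univ_add, Fin.append_left, Fin.append_right, Finset.sum_add_distrib] at h
  have hY : ∑ j : Fin M, ∑ k : Fin K, V (dist (z j) (y k)) = ∑ i, ∑ j, V (dist (y i) (z j)) := by
    rw [Finset.sum_comm]
    exact Finset.sum_congr rfl fun i _ => Finset.sum_congr rfl fun j _ => by rw [dist_comm]
  rw [hY, ← two_mul_interactionEnergy_eq_sum_sum V hV, ← two_mul_interactionEnergy_eq_sum_sum V hV]
    at h
  linarith

/-- Splitting the full double sum along a set of indices and its complement. [folklore] -/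
theorem sum_sum_eq_add_compl (F : Fin N → Fin N → ℝ) (S : Finset (Fin N)) :
    ∑ i, ∑ k, F i k = ∑ i ∈ S, ∑ k ∈ S, F i k + ∑ i ∈ Sᶜ, ∑ k ∈ Sᶜ, F i k +
      (∑ i ∈ S, ∑ k ∈ Sᶜ, F i k + ∑ i ∈ Sᶜ, ∑ k ∈ S, F i k) := by
  rw [← Finset.sum_add_sum_compl S]
  have h1 : ∑ i ∈ S, ∑ k, F i k = ∑ i ∈ S, ∑ k ∈ S, F i k + ∑ i ∈ S, ∑ k ∈ Sᶜ, F i k := by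
    rw [← Finset.sum_add_distrib]
    exact Finset.sum_congr rfl fun i _ => (Finset.sum_add_sum_compl S _).symm
  have h2 : ∑ i ∈ Sᶜ, ∑ k, F i k = ∑ i ∈ Sᶜ, ∑ k ∈ S, F i k + ∑ i ∈ Sᶜ, ∑ k ∈ Sᶜ, F i k := by
    rw [← Finset.sum_add_distrib]
    exact Finset.sum_congr rfl fun i _ => (Finset.sum_add_sum_compl S _).symm
  rw [h1, h2]
  ring

end DoubleSum

/-! ### More on the Lennard-Jones potential -/

/-- `V_LJ(0) = 0` with Lean's convention `0⁻¹ = 0` (never physically used). [folklore] -/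
theorem lennardJones_zero : lennardJones 0 = 0 := by
  simp [lennardJones]

/-- `V_LJ(s) < 0` for `s > 1`. [cite: BlancLewin2015, §1.1 (3)] -/
theorem lennardJones_neg {s : ℝ} (hs : 1 < s) : lennardJones s < 0 := by
  unfold lennardJones
  have h0 : 0 < s⁻¹ := inv_pos.2 (by linarith)
  have h1 : s⁻¹ < 1 := inv_lt_one_of_one_lt₀ hs
  have h6 : (s⁻¹) ^ 6 < 1 := pow_lt_one₀ h0.le h1 (by norm_num)
  have h6p : 0 < (s⁻¹) ^ 6 := pow_pos h0 6
  have h12 : (s⁻¹) ^ 12 = ((s⁻¹) ^ 6) ^ 2 := by ring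
  rw [h12]
  nlinarith

/-- The attractive tail: `V_LJ(s) ≥ -(1/6) t⁻⁶` for `s ≥ t > 0`. [cite: BlancLewin2015, §1.1 (3)] -/
theorem neg_le_lennardJones_of_le {s t : ℝ} (ht : 0 < t) (hs : t ≤ s) :
    -((1 / 6) * (t⁻¹) ^ 6) ≤ lennardJones s := by
  unfold lennardJones
  have h0 : 0 ≤ s⁻¹ := inv_nonneg.2 (ht.le.trans hs)
  have h6 : (s⁻¹) ^ 6 ≤ (t⁻¹) ^ 6 := pow_le_pow_left₀ h0 (inv_anti₀ ht hs) 6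
  nlinarith [pow_nonneg h0 12]

/-- `V_LJ` is continuous away from `0`. [folklore] -/
theorem continuousOn_lennardJones : ContinuousOn lennardJones {0}ᶜ := by
  have h : ContinuousOn (fun r : ℝ => r⁻¹) {0}ᶜ := continuousOn_inv₀
  show ContinuousOn (fun r : ℝ => (1 / 12) * (r⁻¹) ^ 12 - (1 / 6) * (r⁻¹) ^ 6) {0}ᶜ
  exact ((h.pow 12).const_smul (1 / 12 : ℝ)).sub ((h.pow 6).const_smul (1 / 6 : ℝ))

/-- **Hard core from an energy bound.** If `V_LJ(r) < M` with `r > 0` then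
`r ≥ min 1 (3 + 12 max(M,0))⁻¹`: with `u = r⁻⁶`, `u(u-2) = 12 V_LJ(r) < 12 M` forces
`u < 3 + 12 max(M,0)`. [folklore] -/
theorem min_le_of_lennardJones_lt {r M : ℝ} (hr : 0 < r) (h : lennardJones r < M) :
    min 1 (3 + 12 * max M 0)⁻¹ ≤ r := by
  by_contra hlt
  rw [not_le] at hlt
  set U : ℝ := 3 + 12 * max M 0 with hU_def
  have hm0 : 0 ≤ max M 0 := le_max_right _ _
  have hM : M ≤ max M 0 := le_max_left _ _
  have hU3 : 3 ≤ U := by linarith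
  have hU0 : 0 < U := by linarith
  have hδ1 : min 1 U⁻¹ ≤ 1 := min_le_left _ _
  have hδU : min 1 U⁻¹ ≤ U⁻¹ := min_le_right _ _
  have hδ0 : 0 < min 1 U⁻¹ := lt_min one_pos (inv_pos.2 hU0)
  have hr6 : r ^ 6 < U⁻¹ :=
    calc r ^ 6 < (min 1 U⁻¹) ^ 6 := pow_lt_pow_left₀ hlt hr.le (by norm_num)
      _ ≤ (min 1 U⁻¹) ^ 1 := pow_le_pow_of_le_one hδ0.le hδ1 (by norm_num)
      _ ≤ U⁻¹ := by rw [pow_one]; exact hδU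
  have hu : U < (r⁻¹) ^ 6 := by
    rw [inv_pow, lt_inv_comm₀ hU0 (pow_pos hr 6)]
    exact hr6
  unfold lennardJones at h
  set u : ℝ := (r⁻¹) ^ 6 with hu_def
  have h12 : (r⁻¹) ^ 12 = u ^ 2 := by rw [hu_def]; ring
  rw [h12] at h
  have h1 : 1 ≤ u - 2 := by linarith
  have h2 : u ≤ u * (u - 2) := by nlinarith
  have h3 : u * (u - 2) = 12 * ((1 / 12) * u ^ 2 - (1 / 6) * u) := by ring
  linarith

/-- **A pair term is controlled by the total energy**: since `V_LJ ≥ -1/12`, in any configuration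
`V_LJ(|xᵢ - x_k|) ≤ 2 𝓔_N(x) + N²/12` for `i ≠ k`. [folklore] -/
theorem lennardJones_dist_le_two_mul_interactionEnergy {d N : ℕ}
    (x : Fin N → EuclideanSpace ℝ (Fin d)) (i k : Fin N) :
    lennardJones (dist (x i) (x k)) ≤
      2 * interactionEnergy lennardJones x + (N : ℝ) ^ 2 / 12 := by
  rw [two_mul_interactionEnergy_eq_sum_sum lennardJones lennardJones_zero]
  set F : Fin N → Fin N → ℝ := fun i k => lennardJones (dist (x i) (x k)) + 1 / 12 with hF
  have hF0 : ∀ i k, 0 ≤ F i k := fun i k => by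
    have := neg_one_div_le_lennardJones (dist (x i) (x k))
    simp only [hF]
    linarith
  have h1 : F i k ≤ ∑ k', F i k' :=
    Finset.single_le_sum (f := fun k' => F i k') (fun k' _ => hF0 i k') (Finset.mem_univ k)
  have h2 : ∑ k', F i k' ≤ ∑ i', ∑ k', F i' k' :=
    Finset.single_le_sum (f := fun i' => ∑ k', F i' k') (fun i' _ => Finset.sum_nonneg
      fun k' _ => hF0 i' k') (Finset.mem_univ i)
  have h3 : ∑ i', ∑ k', F i' k' =
      ∑ i', ∑ k', lennardJones (dist (x i') (x k')) + (N : ℝ) ^ 2 / 12 := by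
    simp only [hF, Finset.sum_add_distrib, Finset.sum_const, Finset.card_univ, Fintype.card_fin,
      nsmul_eq_mul]
    ring
  have h4 : F i k = lennardJones (dist (x i) (x k)) + 1 / 12 := rfl
  linarith

/-! ### Escaping particles: a dichotomy -/

/-- **Dichotomy for finite point sets.** Given points `x : ι → α` and a threshold `t ≥ 0`, either
some non-empty proper set of indices is at distance `> t` from its complement ("a group of
particles escapes"), or any two points are within `(#ι - 1) t` of each other (chain them along a
path of the graph `|xᵢ - x_k| ≤ t`, which has fewer than `#ι` edges). [folklore] -/
theorem exists_far_or_forall_dist_le {ι α : Type*} [Fintype ι] [DecidableEq ι]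
    [PseudoMetricSpace α] (x : ι → α) {t : ℝ} (ht : 0 ≤ t) :
    (∃ S : Finset ι, S.Nonempty ∧ Sᶜ.Nonempty ∧ ∀ i ∈ S, ∀ k ∈ Sᶜ, t < dist (x i) (x k)) ∨
      ∀ i k, dist (x i) (x k) ≤ ((Fintype.card ι - 1 : ℕ) : ℝ) * t := by
  classical
  let G : SimpleGraph ι :=
    { Adj := fun i k => i ≠ k ∧ dist (x i) (x k) ≤ t
      symm := ⟨fun i k h => ⟨h.1.symm, by rw [dist_comm]; exact h.2⟩⟩
      loopless := ⟨fun i h => h.1 rfl⟩ }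
  have hwalk : ∀ {u v : ι} (p : G.Walk u v), dist (x u) (x v) ≤ (p.length : ℝ) * t := by
    intro u v p
    induction p with
    | nil => simp
    | @cons a b c hab p ih =>
      rw [SimpleGraph.Walk.length_cons, Nat.cast_succ]
      calc dist (x a) (x c) ≤ dist (x a) (x b) + dist (x b) (x c) := dist_triangle _ _ _
        _ ≤ t + (p.length : ℝ) * t := add_le_add hab.2 ih
        _ = ((p.length : ℝ) + 1) * t := by ring
  by_cases hc : G.Preconnected
  · right
    intro i k
    obtain ⟨p, hp⟩ := (hc i k).exists_isPath
    have hlen : p.length < Fintype.card ι := hp.length_lt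
    calc dist (x i) (x k) ≤ (p.length : ℝ) * t := hwalk p
      _ ≤ ((Fintype.card ι - 1 : ℕ) : ℝ) * t :=
        mul_le_mul_of_nonneg_right (by exact_mod_cast Nat.le_sub_one_of_lt hlen) ht
  · left
    simp only [SimpleGraph.Preconnected, not_forall] at hc
    obtain ⟨u, v, huv⟩ := hc
    refine ⟨Finset.univ.filter (G.Reachable u), ⟨u, by simp⟩, ⟨v, by simp [huv]⟩, ?_⟩
    intro i hi k hk
    simp only [Finset.mem_compl, Finset.mem_filter, Finset.mem_univ, true_and] at hi hk
    by_contra hle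
    rw [not_lt] at hle
    have hik : i ≠ k := fun h => hk (h ▸ hi)
    exact hk (hi.trans (SimpleGraph.Adj.reachable (G := G) ⟨hik, hle⟩))


/-! ### Strict binding from minimisers of smaller clusters -/

/-- **Strict binding inequality** `E(K+M) < E(K) + E(M)` (Blanc–Lewin 2015, (6)) for Lennard-Jones,
given minimisers `y`, `z` of the `K`- and `M`-particle problems (`K, M ≥ 1`, `d ≥ 1`): place `z`
translated far away from `y`; all cross distances exceed `1`, where `V_LJ < 0` ("two groups of
particles far away always attract each other"). [cite: BlancLewin2015, §1.2 (6)] -/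
theorem groundStateEnergy_add_lt {d K M : ℕ} (hd : 0 < d) (hK : 0 < K) (hM : 0 < M)
    {y : Fin K → EuclideanSpace ℝ (Fin d)} (hy : IsGroundState lennardJones y)
    {z : Fin M → EuclideanSpace ℝ (Fin d)} (hz : IsGroundState lennardJones z) :
    groundStateEnergy lennardJones d (K + M) <
      groundStateEnergy lennardJones d K + groundStateEnergy lennardJones d M := by
  set R : ℝ := 2 + ∑ i, ‖y i‖ + ∑ j, ‖z j‖ with hR
  set c : EuclideanSpace ℝ (Fin d) := EuclideanSpace.single (⟨0, hd⟩ : Fin d) R with hc_def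
  have hR0 : 0 ≤ R :=
    add_nonneg (add_nonneg zero_le_two (Finset.sum_nonneg fun _ _ => norm_nonneg _))
      (Finset.sum_nonneg fun _ _ => norm_nonneg _)
  have hcn : ‖c‖ = R := by simp [hc_def, abs_of_nonneg hR0]
  set z' : Fin M → EuclideanSpace ℝ (Fin d) := fun j => z j + c with hz'
  have hfar : ∀ i j, 1 < dist (y i) (z' j) := fun i j => by
    have hyi : ‖y i‖ ≤ ∑ i', ‖y i'‖ :=
      Finset.single_le_sum (f := fun i' => ‖y i'‖) (fun _ _ => norm_nonneg _) (Finset.mem_univ i)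
    have hzj : ‖z j‖ ≤ ∑ j', ‖z j'‖ :=
      Finset.single_le_sum (f := fun j' => ‖z j'‖) (fun _ _ => norm_nonneg _) (Finset.mem_univ j)
    have h1 : ‖c‖ - ‖y i - z j‖ ≤ dist (y i) (z' j) := by
      rw [dist_comm, dist_eq_norm]
      have e : c - (z' j - y i) = y i - z j := by simp only [hz']; abel
      have := norm_sub_norm_le c (z' j - y i)
      rw [e] at this
      linarith
    have h2 : ‖y i - z j‖ ≤ ‖y i‖ + ‖z j‖ := norm_sub_le _ _
    linarith
  have hne : ∀ i j, y i ≠ z' j := fun i j h => by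
    have := hfar i j
    rw [h, dist_self] at this
    norm_num at this
  have hz'inj : Function.Injective z' := fun a b hab => hz.1 (add_right_cancel hab)
  set w : Fin (K + M) → EuclideanSpace ℝ (Fin d) := Fin.append y z' with hw
  have hinj : Function.Injective w := by
    intro a b hab
    induction a using Fin.addCases with
    | left a =>
      induction b using Fin.addCases with
      | left b =>
        simp only [hw, Fin.append_left] at hab
        rw [hy.1 hab]
      | right b =>
        simp only [hw, Fin.append_left, Fin.append_right] at hab
        exact absurd hab (hne a b)
    | right a =>
      induction b using Fin.addCases with
      | left b =>
        simp only [hw, Fin.append_left, Fin.append_right] at hab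
        exact absurd hab.symm (hne b a)
      | right b =>
        simp only [hw, Fin.append_right] at hab
        rw [hz'inj hab]
  have hle : groundStateEnergy lennardJones d (K + M) ≤ interactionEnergy lennardJones w :=
    groundStateEnergy_lennardJones_le hinj
  have hdec := interactionEnergy_append lennardJones lennardJones_zero y z'
  have hz'E : interactionEnergy lennardJones z' = interactionEnergy lennardJones z :=
    interactionEnergy_add_const lennardJones z c
  have hneg : ∑ i, ∑ j, lennardJones (dist (y i) (z' j)) < 0 := by
    have hKne : (Finset.univ : Finset (Fin K)).Nonempty := ⟨⟨0, hK⟩, Finset.mem_univ _⟩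
    have hMne : (Finset.univ : Finset (Fin M)).Nonempty := ⟨⟨0, hM⟩, Finset.mem_univ _⟩
    exact Finset.sum_neg (fun i _ => Finset.sum_neg (fun j _ => lennardJones_neg (hfar i j)) hMne)
      hKne
  rw [hw] at hle
  rw [hdec, hz'E, hy.2, hz.2] at hle
  linarith

/-- **Escaping groups cost binding energy.** If the indices split into `S` and `Sᶜ` with all
cross distances `≥ t > 0`, then `𝓔_N(x) ≥ E(#S) + E(#Sᶜ) - #S · #Sᶜ · t⁻⁶/6` for Lennard-Jones
(the two groups have energies `≥ E(#S)`, `≥ E(#Sᶜ)`, and interact through the tail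
`V_LJ ≥ -t⁻⁶/6`). [cite: BlancLewin2015, §1.2] -/
theorem le_interactionEnergy_of_far {d N : ℕ} {x : Fin N → EuclideanSpace ℝ (Fin d)}
    (hx : Function.Injective x) (S : Finset (Fin N)) {t : ℝ} (ht : 0 < t)
    (hfar : ∀ i ∈ S, ∀ k ∈ Sᶜ, t ≤ dist (x i) (x k)) :
    groundStateEnergy lennardJones d S.card + groundStateEnergy lennardJones d Sᶜ.card -
        (S.card : ℝ) * (Sᶜ.card : ℝ) * ((1 / 6) * (t⁻¹) ^ 6) ≤
      interactionEnergy lennardJones x := by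
  have h2 := two_mul_interactionEnergy_eq_sum_sum lennardJones lennardJones_zero x
  rw [sum_sum_eq_add_compl _ S] at h2
  have hS := two_mul_groundStateEnergy_card_le lennardJones lennardJones_zero
    neg_one_div_le_lennardJones hx S
  have hSc := two_mul_groundStateEnergy_card_le lennardJones lennardJones_zero
    neg_one_div_le_lennardJones hx Sᶜ
  have hc1 : ∑ i ∈ S, ∑ k ∈ Sᶜ, -((1 / 6) * (t⁻¹) ^ 6) ≤
      ∑ i ∈ S, ∑ k ∈ Sᶜ, lennardJones (dist (x i) (x k)) :=
    Finset.sum_le_sum fun i hi => Finset.sum_le_sum fun k hk =>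
      neg_le_lennardJones_of_le ht (hfar i hi k hk)
  have hc2 : ∑ i ∈ Sᶜ, ∑ k ∈ S, -((1 / 6) * (t⁻¹) ^ 6) ≤
      ∑ i ∈ Sᶜ, ∑ k ∈ S, lennardJones (dist (x i) (x k)) :=
    Finset.sum_le_sum fun i hi => Finset.sum_le_sum fun k hk =>
      neg_le_lennardJones_of_le ht (by rw [dist_comm]; exact hfar k hk i hi)
  simp only [Finset.sum_const, nsmul_eq_mul] at hc1 hc2
  linarith

/-! ### Compactness modulo translations -/

/-- The Lennard-Jones energy is continuous on the set of `δ`-separated configurations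
(`δ > 0`; `V_LJ` is continuous on `(0, ∞)`). [folklore] -/
theorem continuousOn_interactionEnergy_lennardJones {d N : ℕ} {δ : ℝ} (hδ : 0 < δ) :
    ContinuousOn (fun x : Fin N → EuclideanSpace ℝ (Fin d) => interactionEnergy lennardJones x)
      {x | ∀ i k, i ≠ k → δ ≤ dist (x i) (x k)} := by
  have h : ∀ i k : Fin N, i ≠ k → ContinuousOn
      (fun x : Fin N → EuclideanSpace ℝ (Fin d) => lennardJones (dist (x i) (x k)))
      {x | ∀ i k, i ≠ k → δ ≤ dist (x i) (x k)} := by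
    intro i k hik
    have hf : Continuous fun x : Fin N → EuclideanSpace ℝ (Fin d) => dist (x i) (x k) :=
      (continuous_apply i).dist (continuous_apply k)
    refine continuousOn_lennardJones.comp hf.continuousOn ?_
    intro x hx
    simp only [Set.mem_compl_iff, Set.mem_singleton_iff]
    exact (hδ.trans_le (hx i k hik)).ne'
  unfold interactionEnergy
  exact continuousOn_finsetSum _ fun i _ => continuousOn_finsetSum _ fun k hk =>
    h i k (Finset.mem_Ioi.1 hk).ne

/-- The normalised configurations — particle `i₀` at the origin, all particles in the closed ball
of radius `R ≥ 0` about the origin, mutual distances `≥ δ` — form a compact set. [folklore] -/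
theorem isCompact_setOf_normalised {d N : ℕ} (i₀ : Fin N) {R : ℝ} (hR : 0 ≤ R) (δ : ℝ) :
    IsCompact ({x : Fin N → EuclideanSpace ℝ (Fin d) | x i₀ = 0} ∩ {x | ∀ i, ‖x i‖ ≤ R} ∩
      {x | ∀ i k, i ≠ k → δ ≤ dist (x i) (x k)}) := by
  refine Metric.isCompact_of_isClosed_isBounded ((IsClosed.inter ?_ ?_).inter ?_) ?_
  · exact isClosed_eq (continuous_apply i₀) continuous_const
  · rw [Set.setOf_forall]
    exact isClosed_iInter fun i =>
      isClosed_le (continuous_norm.comp (continuous_apply i)) continuous_const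
  · rw [Set.setOf_forall]
    refine isClosed_iInter fun i => ?_
    rw [Set.setOf_forall]
    refine isClosed_iInter fun k => ?_
    exact isClosed_imp isOpen_const
      (isClosed_le continuous_const ((continuous_apply i).dist (continuous_apply k)))
  · refine (Metric.isBounded_closedBall (x := (0 : Fin N → EuclideanSpace ℝ (Fin d)))
      (r := R)).subset ?_
    rintro x ⟨⟨-, hx⟩, -⟩
    rw [mem_closedBall, dist_zero_right]
    exact (pi_norm_le_iff_of_nonneg hR).2 hx

/-- **Compactness modulo translations** (Blanc–Lewin 2015, §1.2, footnote to (6): "if all the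
`xⱼ`'s are uniformly bounded (after applying an appropriate translation) then we get the existence
of a minimizer using the continuity of `V`"). If every configuration of `N` distinct points
with Lennard-Jones energy below a level `B' > E(N)` has diameter `≤ R` and mutual distances
`≥ δ > 0`, then `E(N)` has a minimiser: after translating particle `i₀` to the origin such
configurations lie in a compact set on which the energy is continuous, and a minimiser of the
energy on that set is a ground state.
[cite: BlancLewin2015, §1.2 (6)] -/
theorem exists_isGroundState_lennardJones_of_bounds {d N : ℕ} (i₀ : Fin N) {B' R δ : ℝ}
    (hne : Nonempty {x : Fin N → EuclideanSpace ℝ (Fin d) // Function.Injective x})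
    (hB' : groundStateEnergy lennardJones d N < B') (hδ : 0 < δ)
    (hR : ∀ x : Fin N → EuclideanSpace ℝ (Fin d), Function.Injective x →
      interactionEnergy lennardJones x < B' → ∀ i k, dist (x i) (x k) ≤ R)
    (hsep : ∀ x : Fin N → EuclideanSpace ℝ (Fin d), Function.Injective x →
      interactionEnergy lennardJones x < B' → ∀ i k, i ≠ k → δ ≤ dist (x i) (x k)) :
    ∃ x : Fin N → EuclideanSpace ℝ (Fin d), IsGroundState lennardJones x := by
  -- a near-minimiser `x₁`
  have hB'' := hB'
  unfold groundStateEnergy at hB''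
  obtain ⟨⟨x₁, hx₁⟩, hx₁E⟩ := exists_lt_of_ciInf_lt hB''
  simp only at hx₁E
  have hR0 : 0 ≤ R := by
    have := hR x₁ hx₁ hx₁E i₀ i₀
    rwa [dist_self] at this
  -- the compact set of normalised configurations
  set C : Set (Fin N → EuclideanSpace ℝ (Fin d)) :=
    {x | x i₀ = 0} ∩ {x | ∀ i, ‖x i‖ ≤ R} ∩ {x | ∀ i k, i ≠ k → δ ≤ dist (x i) (x k)} with hC
  have hCcpt : IsCompact C := isCompact_setOf_normalised i₀ hR0 δ
  have hcont : ContinuousOn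
      (fun x : Fin N → EuclideanSpace ℝ (Fin d) => interactionEnergy lennardJones x) C :=
    (continuousOn_interactionEnergy_lennardJones hδ).mono Set.inter_subset_right
  -- normalisation: translate `x i₀` to the origin
  have hnorm : ∀ x : Fin N → EuclideanSpace ℝ (Fin d), Function.Injective x →
      interactionEnergy lennardJones x < B' → (fun i => x i - x i₀) ∈ C := by
    intro x hx hxE
    refine ⟨⟨?_, fun i => ?_⟩, fun i k hik => ?_⟩
    · show x i₀ - x i₀ = 0
      exact sub_self _
    · rw [← dist_eq_norm]
      exact hR x hx hxE i i₀
    · rw [dist_sub_right]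
      exact hsep x hx hxE i k hik
  have hx₀C : (fun i => x₁ i - x₁ i₀) ∈ C := hnorm x₁ hx₁ hx₁E
  have hx₀E : interactionEnergy lennardJones (fun i => x₁ i - x₁ i₀) < B' := by
    rw [interactionEnergy_sub_const]
    exact hx₁E
  -- minimise the (continuous) energy over the compact set `C`
  obtain ⟨xm, hxmC, hmin⟩ := hCcpt.exists_isMinOn ⟨_, hx₀C⟩ hcont
  rw [isMinOn_iff] at hmin
  have hxm_inj : Function.Injective xm := by
    intro i k h
    by_contra hik
    have := hxmC.2 i k hik
    rw [h, dist_self] at this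
    exact absurd this (not_le.2 hδ)
  have hxmE : interactionEnergy lennardJones xm < B' := (hmin _ hx₀C).trans_lt hx₀E
  refine ⟨xm, hxm_inj, le_antisymm ?_ (groundStateEnergy_lennardJones_le hxm_inj)⟩
  unfold groundStateEnergy
  refine le_ciInf fun y => ?_
  by_cases hyE : interactionEnergy lennardJones y.1 < B'
  · have h := hmin _ (hnorm y.1 y.2 hyE)
    rwa [interactionEnergy_sub_const] at h
  · exact hxmE.le.trans (not_lt.1 hyE)

/-! ### Existence of ground states: the induction step and the discharge -/

/-- **The binding gap.** If `E(N) < E(K) + E(N-K)` for all `1 ≤ K < N` (`N ≥ 2`), then there are a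
threshold `t > 0` and a level `B' > E(N)` such that every configuration of `N` distinct points in
which a non-empty proper group of particles is farther than `t` from the rest has Lennard-Jones
energy `≥ B'`: with `B = min_K E(K) + E(N-K)` and `N² t⁻⁶/6 ≤ (B - E(N))/2`, take
`B' = B - N² t⁻⁶/6` and use `le_interactionEnergy_of_far` (Blanc–Lewin 2015, §1.2, footnote to
(6): "if `K` particles escape, then we get a contradiction from (6)").
[cite: BlancLewin2015, §1.2 (6)] -/
theorem exists_level_of_binding {d N : ℕ} (hN : 2 ≤ N)
    (hbind : ∀ K, 1 ≤ K → K < N → groundStateEnergy lennardJones d N <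
      groundStateEnergy lennardJones d K + groundStateEnergy lennardJones d (N - K)) :
    ∃ t B' : ℝ, 0 < t ∧ groundStateEnergy lennardJones d N < B' ∧
      ∀ x : Fin N → EuclideanSpace ℝ (Fin d), Function.Injective x →
        ∀ S : Finset (Fin N), S.Nonempty → Sᶜ.Nonempty →
          (∀ i ∈ S, ∀ k ∈ Sᶜ, t < dist (x i) (x k)) → B' ≤ interactionEnergy lennardJones x := by
  set E : ℕ → ℝ := fun K => groundStateEnergy lennardJones d K with hE
  -- the binding gap `g = B - E(N) > 0` and the threshold `t`
  obtain ⟨K₀, hK₀, hK₀min⟩ := Finset.exists_min_image (Finset.Ico 1 N)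
    (fun K => E K + E (N - K)) ⟨1, by simp; omega⟩
  rw [Finset.mem_Ico] at hK₀
  have hB : E N < E K₀ + E (N - K₀) := hbind K₀ hK₀.1 hK₀.2
  set g : ℝ := E K₀ + E (N - K₀) - E N with hg_def
  have hg : 0 < g := by simp only [hg_def]; linarith
  set t : ℝ := max 1 ((N : ℝ) ^ 2 / (3 * g)) with ht_def
  have ht1 : 1 ≤ t := le_max_left _ _
  have ht0 : 0 < t := by linarith
  have hN0 : 0 < N := by omega
  have hNpos : (0 : ℝ) < N := by exact_mod_cast hN0
  have htail : (N : ℝ) ^ 2 * ((1 / 6) * (t⁻¹) ^ 6) ≤ g / 2 := by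
    have h1 : (t⁻¹) ^ 6 ≤ t⁻¹ :=
      pow_le_of_le_one (inv_nonneg.2 ht0.le) (inv_le_one_of_one_le₀ ht1) (by norm_num)
    have h2 : t⁻¹ ≤ ((N : ℝ) ^ 2 / (3 * g))⁻¹ := inv_anti₀ (by positivity) (le_max_right _ _)
    rw [inv_div] at h2
    have h3 : (N : ℝ) ^ 2 * (3 * g / (N : ℝ) ^ 2) = 3 * g := by field_simp
    nlinarith [pow_pos hNpos 2]
  refine ⟨t, E K₀ + E (N - K₀) - (N : ℝ) ^ 2 * ((1 / 6) * (t⁻¹) ^ 6), ht0, ?_, ?_⟩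
  · show E N < _
    linarith
  intro x hx S hS hSc hfar
  have h := le_interactionEnergy_of_far hx S ht0 fun i hi k hk => (hfar i hi k hk).le
  have hcard : S.card + Sᶜ.card = N := by rw [Finset.card_add_card_compl, Fintype.card_fin]
  have hS1 : 1 ≤ S.card := Finset.card_pos.2 hS
  have hSc1 : 1 ≤ Sᶜ.card := Finset.card_pos.2 hSc
  have hSN : S.card < N := by omega
  have hmin := hK₀min S.card (by rw [Finset.mem_Ico]; exact ⟨hS1, hSN⟩)
  have hcs : Sᶜ.card = N - S.card := by omega
  rw [hcs] at h
  have hprod : (S.card : ℝ) * ((N - S.card : ℕ) : ℝ) ≤ (N : ℝ) ^ 2 := by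
    have a : (S.card : ℝ) ≤ N := by exact_mod_cast hSN.le
    have b : ((N - S.card : ℕ) : ℝ) ≤ N := by exact_mod_cast Nat.sub_le N S.card
    have a0 : (0 : ℝ) ≤ S.card := Nat.cast_nonneg _
    have b0 : (0 : ℝ) ≤ ((N - S.card : ℕ) : ℝ) := Nat.cast_nonneg _
    nlinarith
  have hc0 : 0 ≤ (1 / 6) * (t⁻¹) ^ 6 := by positivity
  have key := mul_le_mul_of_nonneg_right hprod hc0
  simp only [hE] at hmin h ⊢
  linarith

/-- In dimension `d ≥ 1` there are configurations of `N` distinct points (on the first axis).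
[folklore] -/
theorem nonempty_injective_config {d : ℕ} (hd : 0 < d) (N : ℕ) :
    Nonempty {x : Fin N → EuclideanSpace ℝ (Fin d) // Function.Injective x} := by
  refine ⟨⟨fun i => EuclideanSpace.single (⟨0, hd⟩ : Fin d) ((i : ℕ) : ℝ), fun i j hij => ?_⟩⟩
  have h := congrArg (fun v : EuclideanSpace ℝ (Fin d) => v ⟨0, hd⟩) hij
  have h' : ((i : ℕ) : ℝ) = ((j : ℕ) : ℝ) := by simpa using h
  exact Fin.ext (Nat.cast_injective h')

/-- **The induction step** (Blanc–Lewin 2015, §1.2 with the footnote to (6)): in dimension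
`d ≥ 1`, if the Lennard-Jones problems with fewer than `N` particles have minimisers, so does the
`N`-particle problem. Strict binding `E(N) < E(K) + E(N-K)` follows from the smaller minimisers
(`groundStateEnergy_add_lt`); by `exists_level_of_binding` a configuration in which a group of
particles is farther than `t` from the rest has energy `≥ B' > E(N)`, so configurations with
energy `< B'` are `t`-chained (diameter `≤ (N-1) t`, `exists_far_or_forall_dist_le`) and, by the
energy bound, `δ`-separated (`min_le_of_lennardJones_lt`); conclude by compactness modulo
translations (`exists_isGroundState_lennardJones_of_bounds`). [cite: BlancLewin2015, §1.2 (6)] -/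
theorem exists_isGroundState_lennardJones_of_lt {d : ℕ} (hd : 0 < d) (N : ℕ)
    (ih : ∀ K < N, ∃ y : Fin K → EuclideanSpace ℝ (Fin d), IsGroundState lennardJones y) :
    ∃ x : Fin N → EuclideanSpace ℝ (Fin d), IsGroundState lennardJones x := by
  haveI hne := nonempty_injective_config hd N
  rcases le_or_gt N 1 with hN1 | hN2
  · -- at most one particle: no interaction
    haveI : Subsingleton (Fin N) := Fin.subsingleton_iff_le_one.2 hN1
    refine ⟨fun _ => 0, Function.injective_of_subsingleton _, ?_⟩
    unfold groundStateEnergy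
    simp only [interactionEnergy_of_subsingleton, ciInf_const]
  -- `N ≥ 2`
  have hN0 : 0 < N := by omega
  -- (a) strict binding `E(N) < E(K) + E(N-K)` from the minimisers of the smaller problems
  have hbind : ∀ K, 1 ≤ K → K < N → groundStateEnergy lennardJones d N <
      groundStateEnergy lennardJones d K + groundStateEnergy lennardJones d (N - K) := by
    intro K hK1 hKN
    obtain ⟨y, hy⟩ := ih K hKN
    obtain ⟨z, hz⟩ := ih (N - K) (by omega)
    have := groundStateEnergy_add_lt hd hK1 (by omega) hy hz
    rwa [Nat.add_sub_cancel' hKN.le] at this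
  -- (b)-(c) the level `B'` below which no group of particles escapes farther than `t`
  obtain ⟨t, B', ht0, hB', hfarE⟩ := exists_level_of_binding hN2 hbind
  -- (c') configurations with energy `< B'` are `t`-chained: diameter `≤ (N-1) t`
  have hnear : ∀ x : Fin N → EuclideanSpace ℝ (Fin d), Function.Injective x →
      interactionEnergy lennardJones x < B' →
        ∀ i k, dist (x i) (x k) ≤ ((N - 1 : ℕ) : ℝ) * t := by
    intro x hx hxE i k
    rcases exists_far_or_forall_dist_le x ht0.le with ⟨S, hS, hSc, hfar⟩ | h
    · exact absurd (hfarE x hx S hS hSc hfar) (not_le.2 hxE)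
    · have := h i k
      rwa [Fintype.card_fin] at this
  -- (d) configurations with energy `< B'` are `δ`-separated
  set M : ℝ := 2 * B' + (N : ℝ) ^ 2 / 12 with hM_def
  have hδ0 : 0 < min 1 (3 + 12 * max M 0)⁻¹ :=
    lt_min one_pos (inv_pos.2 (by have := le_max_right M 0; linarith))
  have hsep : ∀ x : Fin N → EuclideanSpace ℝ (Fin d), Function.Injective x →
      interactionEnergy lennardJones x < B' →
        ∀ i k, i ≠ k → min 1 (3 + 12 * max M 0)⁻¹ ≤ dist (x i) (x k) := by
    intro x hx hxE i k hik
    refine min_le_of_lennardJones_lt (dist_pos.2 (hx.ne hik)) ?_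
    have := lennardJones_dist_le_two_mul_interactionEnergy x i k
    show lennardJones (dist (x i) (x k)) < M
    simp only [hM_def]
    linarith
  -- (e) compactness modulo translations
  exact exists_isGroundState_lennardJones_of_bounds ⟨0, hN0⟩ hne hB' hδ0 hnear hsep

/-- **Existence of Lennard-Jones ground states** (discharge of `LennardJonesGroundStatesExist`):
for every `N` the `N`-particle Lennard-Jones energy in `ℝ³` is minimised by a configuration of
distinct points — strong induction on `N` via `exists_isGroundState_lennardJones_of_lt`
(strict binding (6) from the smaller minimisers, then compactness modulo translations), the
argument printed in Blanc–Lewin 2015, §1.2 (p. 3) and the footnote to (6).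
[cite: BlancLewin2015, §1.2 (6)] -/
theorem LennardJonesGroundStatesExist_holds : LennardJonesGroundStatesExist := fun N =>
  Nat.strong_induction_on N fun N ih =>
    exists_isGroundState_lennardJones_of_lt (by norm_num) N ih

end Literature.MathematicalPhysics.StatisticalMechanics

end
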